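import Summits.BirchSwinnertonDyer.BirchSwinnertonDyer.Theorems.ManinLocalTwoThreeCutLatticesHeckeStable
import Summits.BirchSwinnertonDyer.BirchSwinnertonDyer.Theorems.ManinLocalTwoThreeConwayNortonTwistPairs
import HarnessLib

/-!
# The pinning kernel, part H: certified tables under `T_p` / `U_p` and the `χ₋₃`-twist (HECKE/TWIST-CLOSURE bases)

Cell `bsd-f2-manin`, route `ManinLocalTwoThree`, cruxes C2 `ManinOddAtFour` (stmt-BirchSwinnertonDyer-22967) / C3
`ManinPrimeToThreeAtNine` (stmt-BirchSwinnertonDyer-22968), an g58 (LENS analytic/periods); helper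
(`--supports stmt-BirchSwinnertonDyer-22967`).  At levels where the cuspidal `η`-quotients do NOT span `S₂(Γ₀(N))`
(`171 = 9·19`: 3 of them, `g = 17`) the basis fed to part B `PinningKernel.exists_smul_eq_sum_of_certs` is the closure of
the `η` seeds under the tree's Hecke operators `T_p = heckeT (Γ₀(N)) 2 p` (`U_p` for `p ∣ N`) and the quadratic twist
`charTwist N … (·/3)` (`9 ∣ N`).  This part turns a certified coefficient table of `f` into certified tables of `T_p f` and of
`f ⊗ (·/3)` by a DECIDABLE list identity, using only the landed `q`-expansion formulas
`cuspCoeff_heckeT_weight_two` (`aₙ(T_p f) = a_{pn}(f) + 𝟙_{p∤N}·p·𝟙_{p∣n}·a_{n/p}(f)`) and `cuspCoeff_charTwist`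
(`aₙ(f ⊗ χ) = χ(n)·aₙ(f)` for the primitive quadratic `χ = (·/3)`).
HONEST FRAMING: bookkeeping lemmas on integer lists; nothing here proves C2/C3, Manin's conjecture or BSD.
[cite: DiamondShurman2005, Prop. 5.2.2(a)] [cite: Shimura1971, Prop. 3.64] [cite: CremonaAlgorithms1997, §2.10]
-/

set_option autoImplicit false
-- lint-debt: the directory name repeats the summit name (sibling precedent `ManinLocalTwoThreePinningKernel.lean`)
set_option linter.dupNamespace false

noncomputable section

open scoped MatrixGroups ModularForm
open ModularForm CongruenceSubgroup
open Literature.NumberTheory.EllipticCurves Literature.NumberTheory.EllipticCurves.ModularForms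

namespace Summit.BirchSwinnertonDyer.BirchSwinnertonDyer.Theorems.ManinLocalTwoThree.PinningKernel

/-! ## §H1 Tables under `T_p` / `U_p` (weight `2`) -/

section Hecke

variable {N : ℕ} [NeZero N]

/-- **Certified table of `T_p f` from a certified table of `f`** (weight `2`, level `Γ₀(N)`; `U_p` when `p ∣ N`): if `t`
tabulates `aₘ(f)` for `m < p·K` and `t'` satisfies the decidable identity
`t'[n] = t[pn] + 𝟙_{p∤N}·p·𝟙_{p∣n}·t[n/p]` for `n < K`, then `t'` tabulates `aₙ(T_p f)` for `n < K`.
[cite: DiamondShurman2005, Prop. 5.2.2(a)] -/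
theorem table_heckeT {p : ℕ} [NeZero p] (hp : p.Prime) (K : ℕ) (f : CuspForm (Gamma0 N) 2) (t t' : List ℤ)
    (ht : ∀ m < p * K, ((t.getD m 0 : ℤ) : ℂ) = cuspCoeff f m)
    (h : ∀ n < K, t'.getD n 0 =
      t.getD (p * n) 0 + (if p ∣ N then 0 else (p : ℤ) * (if p ∣ n then t.getD (n / p) 0 else 0))) :
    ∀ n < K, ((t'.getD n 0 : ℤ) : ℂ) = cuspCoeff (heckeT (Gamma0 N) 2 p f) n := by
  intro n hn
  have hp1 : 1 ≤ p := hp.one_lt.le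
  rw [cuspCoeff_heckeT_weight_two hp, h n hn]
  push_cast
  rw [ht (p * n) (Nat.mul_lt_mul_of_pos_left hn hp.pos)]
  congr 1
  split_ifs with hpN hpn
  · rfl
  · rw [ht (n / p) (lt_of_le_of_lt (Nat.div_le_self n p) (lt_of_lt_of_le hn (Nat.le_mul_of_pos_left K hp.pos)))]
  · simp

end Hecke

/-! ## §H2 Tables under the `(·/3)`-twist -/

section Twist

/-- `χ₋₃ = (·/3)` as an integer-valued function of `n mod 3`. [folklore] -/
def chi3 (n : ℕ) : ℤ := if n % 3 = 0 then 0 else if n % 3 = 1 then 1 else -1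

/-- `(n/3) = chi3 n`. [folklore] -/
theorem legendreSym_three (n : ℕ) : legendreSym 3 (n : ℤ) = chi3 n := by
  rw [legendreSym.mod, chi3]
  have h : (n : ℤ) % (3 : ℕ) = ((n % 3 : ℕ) : ℤ) := by push_cast; rfl
  rw [h]
  have h3 : n % 3 < 3 := Nat.mod_lt _ (by norm_num)
  rcases (by omega : n % 3 = 0 ∨ n % 3 = 1 ∨ n % 3 = 2) with h0 | h1 | h2
  · rw [h0, if_pos rfl, Nat.cast_zero]; exact legendreSym.at_zero 3
  · rw [h1, if_neg (by norm_num), if_pos rfl, Nat.cast_one]; exact legendreSym.at_one 3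
  · rw [h2, if_neg (by norm_num), if_neg (by norm_num)]
    exact (legendreSym.eq_neg_one_iff' 3).mpr (by unfold IsSquare; decide)

variable {N : ℕ} [NeZero N]

/-- The value of the complexified `(·/3)` at `n`. [folklore] -/
theorem quadraticChar_three_apply (n : ℕ) :
    (quadraticChar (ZMod 3)).ringHomComp (Int.castRingHom ℂ) n = ((chi3 n : ℤ) : ℂ) := by
  rw [quadraticChar_ringHomComp_apply_natCast 3 n, legendreSym_three]

/-- **Certified table of `f ⊗ (·/3)` from a certified table of `f`** (`9 ∣ N`; the twist is the tree's
`charTwist N … (isQuadratic_quadraticChar_ringHomComp 3)` at the same level): if `t` tabulates `aₘ(f)` for `m < K`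
and `t'[n] = chi3 n · t[n]` for `n < K` (decidable), then `t'` tabulates `aₙ(f ⊗ (·/3))` for `n < K`.
[cite: Shimura1971, Prop. 3.64] -/
theorem table_twist3 (h9 : 3 ^ 2 ∣ N) (K : ℕ) (f : CuspForm (Gamma0 N) 2) (t t' : List ℤ)
    (ht : ∀ m < K, ((t.getD m 0 : ℤ) : ℂ) = cuspCoeff f m)
    (h : ∀ n < K, t'.getD n 0 = chi3 n * t.getD n 0) :
    ∀ n < K, ((t'.getD n 0 : ℤ) : ℂ) =
      cuspCoeff (charTwist N dvd_rfl h9 (isQuadratic_quadraticChar_ringHomComp 3) f) n := by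
  intro n hn
  rw [cuspCoeff_charTwist (L := N) (hN := dvd_rfl) (hm := h9) (hχ := isQuadratic_quadraticChar_ringHomComp 3)
    (hprim := isPrimitive_quadraticChar_ringHomComp 3 (by norm_num)) (f := f) (n := n),
    quadraticChar_three_apply, h n hn, ← ht n hn]
  push_cast
  ring

/-- Truncating a certified table: a table to depth `K'` is a table to every depth `K ≤ K'` (used to read the seed
tables, certified deep, at the working depth). [folklore] -/
theorem table_mono {V : Type*} (coef : ℕ → V → ℂ) {K K' : ℕ} (hK : K ≤ K') (F : V) (t t' : List ℤ)
    (ht : ∀ m < K', ((t.getD m 0 : ℤ) : ℂ) = coef m F) (h : ∀ n < K, t'.getD n 0 = t.getD n 0) :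
    ∀ n < K, ((t'.getD n 0 : ℤ) : ℂ) = coef n F :=
  fun n hn ↦ by rw [h n hn]; exact ht n (lt_of_lt_of_le hn hK)

end Twist

/-! ## §H3 Kernel sanity checks -/

/-- `chi3` on `0 … 5`. [folklore] -/
theorem chi3_first : (List.range 6).map chi3 = [0, 1, -1, 0, 1, -1] := by decide

end Summit.BirchSwinnertonDyer.BirchSwinnertonDyer.Theorems.ManinLocalTwoThree.PinningKernel

end
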